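import Summits.CriticalPhenomena.PercolationContinuityZ3.Theorems.SahiMasterFamilyFCombShiftDetCube
import HarnessLib

/-!
# The Kleitman–compression matching: `S ∖ H → S ∖ dnSeq s H` with disjoint pairs

Support file (cell `prim-bnk`, seat bnk-2 gen 21; `--supports stmt-CriticalPhenomena-4575`; complete write-up
`run/shared/lean/prim/prim-l12/PROOF-F-inequality.md`).  No definition, no `sorry`, standard axioms.  Part of the proof of the comb
inequality `K(A,B,G) ≥ 0` for ALL monotone third events `G`, hence of the master-family inequality
`(1+μG)μ(A∩B∩G) ≥ μG·μ(A∩B) + μ(A∩G)μ(B∩G)` for all increasing `A,B,G` and every product measure (`…FCombAllThirdEvents`).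

**THEOREM (`disjoint_matching`).**  Let `S` be a lower-closed family of cube points (a simplicial complex), `H ⊆ S` relatively upper-closed,
`s` a list of distinct coordinates.  Then there is a bijection `ψ : S ∖ H → S ∖ dnSeq s H` with `x ∧ ψ(x) = 0` for all `x`.
For `S = σG`, `H = G ∩ σG` (`G` an up-set, `σ` the antipode) and a full `s` this is the Kleitman-type lemma (♣) of the memo:
an increasing bijection from `σG ∖ G` onto `G ∖ C(G∩σG)`, `C` the full up-compression — Kleitman–Hall's lemma is the weaker statement with
target `G ∖ (G∩σG)`.  Proof: the disjointness matrix factors as `ζ[L,L]ᵀ·Λ·ζ[L,T]` (`sum_zeta_zeta_disj`), and `det ζ[L,T] = ±det ζ[dnSeq s H, H]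
= ±1` by the block identity `ζ[S,S]·(1 B′; 0 D′) = (ζ[L,T] 0; ✱ 1)` for the unitriangular `ζ[S,S]` with inverse `Λ ζ Λ` (`sum_zeta_mu`) and
THEOREM S; a nonzero determinant has a nonzero permutation term. [this work]
-/

namespace Summit.CriticalPhenomena.PercolationContinuityZ3.Theorems

namespace SahiFComb

open Finset

variable {n : ℕ}

/-! ### 7. Cube identities: Möbius inversion and the disjointness factorisation -/

/-- Sum over the cube of a product of per-coordinate factors. -/
theorem sum_prod_coord (h : Fin n → Bool → ℤ) :
    ∑ y : Fin n → Bool, ∏ i, h i (y i) = ∏ i, (h i false + h i true) := by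
  have e := (Finset.prod_univ_sum (fun (_ : Fin n) => (Finset.univ : Finset Bool)) h)
  rw [Fintype.piFinset_univ] at e
  rw [← e]
  refine Finset.prod_congr rfl (fun i _ => ?_)
  rw [Fintype.sum_bool, add_comm]

/-- `(-1)^{|y|}` as a product over coordinates. [folklore] -/
theorem neg_one_pow_wt (y : Fin n → Bool) : ((-1 : ℤ) ^ (wt y)) = ∏ i, (if y i = true then (-1 : ℤ) else 1) := by
  unfold wt
  rw [Finset.prod_ite, Finset.prod_const_one, mul_one, Finset.prod_const]

/-- The zeta kernel as a product of coordinate indicators. [folklore] -/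
theorem zeta_eq_prod (x y : Fin n → Bool) :
    zeta x y = ∏ i, (if (x i = true → y i = true) then (1 : ℤ) else 0) := by
  rw [Finset.prod_boole]
  unfold zeta
  by_cases h : ∀ i, x i = true → y i = true
  · rw [if_pos h, if_pos (fun i _ => h i)]
  · rw [if_neg h, if_neg (by simpa using h)]

/-- Möbius inversion on a lower-closed family `S`: `Σ_{y ∈ S} ζ(x,y) μ(y,z) = [x = z]` for `x, z ∈ S`,
with `μ(y,z) = (-1)^{|y|+|z|} ζ(y,z)`. -/
theorem sum_zeta_mu (S : Finset (Fin n → Bool))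
    (hS : ∀ z ∈ S, ∀ y : Fin n → Bool, (∀ i, y i = true → z i = true) → y ∈ S)
    (x z : Fin n → Bool) (hz : z ∈ S) :
    ∑ y ∈ S, zeta x y * ((-1 : ℤ) ^ (wt y + wt z) * zeta y z) = if x = z then 1 else 0 := by
  -- extend the sum to the whole cube
  have hext : ∑ y ∈ S, zeta x y * ((-1 : ℤ) ^ (wt y + wt z) * zeta y z)
      = ∑ y : Fin n → Bool, zeta x y * ((-1 : ℤ) ^ (wt y + wt z) * zeta y z) := by
    apply Finset.sum_subset (Finset.subset_univ S)
    intro y _ hy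
    have : zeta y z = 0 := zeta_of_not_le (fun h => hy (hS z hz y h))
    rw [this]; ring
  rw [hext]
  -- per-coordinate factorisation of the summand
  have hterm : ∀ y : Fin n → Bool, zeta x y * ((-1 : ℤ) ^ (wt y + wt z) * zeta y z) =
      (-1 : ℤ) ^ (wt z) * ∏ i, ((if (x i = true → y i = true) then (1 : ℤ) else 0) *
        ((if (y i = true → z i = true) then (1 : ℤ) else 0) * (if y i = true then (-1 : ℤ) else 1))) := by
    intro y
    rw [Finset.prod_mul_distrib, Finset.prod_mul_distrib, ← zeta_eq_prod, ← zeta_eq_prod, ← neg_one_pow_wt, pow_add]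
    ring
  simp_rw [hterm]
  have hs := sum_prod_coord (fun i b => (if (x i = true → b = true) then (1 : ℤ) else 0) *
        ((if (b = true → z i = true) then (1 : ℤ) else 0) * (if b = true then (-1 : ℤ) else 1)))
  beta_reduce at hs
  rw [← Finset.mul_sum, hs]
  -- evaluate the coordinate factors
  have hfac : ∀ i : Fin n, ((if (x i = true → false = true) then (1 : ℤ) else 0) *
        ((if (false = true → z i = true) then (1 : ℤ) else 0) * (if false = true then (-1 : ℤ) else 1)) +
      (if (x i = true → true = true) then (1 : ℤ) else 0) *
        ((if (true = true → z i = true) then (1 : ℤ) else 0) * (if true = true then (-1 : ℤ) else 1)))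
      = (if x i = true then 0 else 1) + (if z i = true then -1 else 0) := by
    intro i
    cases x i <;> cases z i <;> simp
  rw [Finset.prod_congr rfl (fun i _ => hfac i)]
  by_cases hxz : x = z
  · subst hxz
    rw [if_pos rfl]
    have : ∏ i, ((if x i = true then (0 : ℤ) else 1) + (if x i = true then -1 else 0)) = ∏ i, (if x i = true then (-1 : ℤ) else 1) :=
      Finset.prod_congr rfl (fun i _ => by cases x i <;> simp)
    rw [this, ← neg_one_pow_wt, ← pow_add, ← two_mul, pow_mul]
    simp
  · rw [if_neg hxz]
    obtain ⟨i, hi⟩ := Function.ne_iff.mp hxz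
    rw [Finset.prod_eq_zero (Finset.mem_univ i)]
    · ring
    · revert hi; cases x i <;> cases z i <;> simp

/-- Disjointness factorisation on a lower-closed family `L`: `Σ_{F ∈ L} ζ(F,x) (-1)^{|F|} ζ(F,K) = [x ∧ K = 0]` for `x ∈ L`. -/
theorem sum_zeta_zeta_disj (L : Finset (Fin n → Bool))
    (hL : ∀ z ∈ L, ∀ y : Fin n → Bool, (∀ i, y i = true → z i = true) → y ∈ L)
    (x K : Fin n → Bool) (hx : x ∈ L) :
    ∑ F ∈ L, zeta F x * ((-1 : ℤ) ^ (wt F) * zeta F K) = disj x K := by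
  have hext : ∑ F ∈ L, zeta F x * ((-1 : ℤ) ^ (wt F) * zeta F K)
      = ∑ F : Fin n → Bool, zeta F x * ((-1 : ℤ) ^ (wt F) * zeta F K) := by
    apply Finset.sum_subset (Finset.subset_univ L)
    intro F _ hF
    have : zeta F x = 0 := zeta_of_not_le (fun h => hF (hL x hx F h))
    rw [this]; ring
  rw [hext]
  have hterm : ∀ F : Fin n → Bool, zeta F x * ((-1 : ℤ) ^ (wt F) * zeta F K) =
      ∏ i, ((if (F i = true → x i = true) then (1 : ℤ) else 0) *
        ((if F i = true then (-1 : ℤ) else 1) * (if (F i = true → K i = true) then (1 : ℤ) else 0))) := by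
    intro F
    rw [Finset.prod_mul_distrib, Finset.prod_mul_distrib, ← zeta_eq_prod, ← zeta_eq_prod, ← neg_one_pow_wt]
  simp_rw [hterm]
  have hs := sum_prod_coord (fun i b => (if (b = true → x i = true) then (1 : ℤ) else 0) *
        ((if b = true then (-1 : ℤ) else 1) * (if (b = true → K i = true) then (1 : ℤ) else 0)))
  beta_reduce at hs
  rw [hs]
  have hfac : ∀ i : Fin n, ((if (false = true → x i = true) then (1 : ℤ) else 0) *
        ((if false = true then (-1 : ℤ) else 1) * (if (false = true → K i = true) then (1 : ℤ) else 0)) +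
      (if (true = true → x i = true) then (1 : ℤ) else 0) *
        ((if true = true then (-1 : ℤ) else 1) * (if (true = true → K i = true) then (1 : ℤ) else 0)))
      = if (x i = true ∧ K i = true) then 0 else 1 := by
    intro i
    cases x i <;> cases K i <;> simp
  rw [Finset.prod_congr rfl (fun i _ => hfac i)]
  unfold disj
  by_cases h : ∀ i, ¬ (x i = true ∧ K i = true)
  · rw [if_pos h]
    exact Finset.prod_eq_one (fun i _ => by rw [if_neg (h i)])
  · rw [if_neg h]
    push Not at h
    obtain ⟨i, hi⟩ := h
    exact Finset.prod_eq_zero (Finset.mem_univ i) (by rw [if_pos hi])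


/-! ### 8. The disjoint matching `S ∖ H → S ∖ dnSeq s H` -/

/-- A family closed under going down is closed under lowering single coordinates. -/
theorem update_false_mem_of_lower {S : Finset (Fin n → Bool)}
    (hS : ∀ z ∈ S, ∀ y : Fin n → Bool, (∀ i, y i = true → z i = true) → y ∈ S) :
    ∀ x ∈ S, ∀ j, Function.update x j false ∈ S := by
  intro x hx j
  refine hS x hx _ (fun i hi => ?_)
  by_cases hij : i = j
  · subst hij; simp at hi
  · rw [Function.update_of_ne hij] at hi; exact hi

/-- **The disjoint matching.**  Let `S` be a lower-closed family of cube points, `H ⊆ S` relatively upper-closed in `S`,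
and `s` a list of distinct coordinates.  Then there is a bijection `ψ : S ∖ H → S ∖ dnSeq s H` such that `x` and `ψ x`
have no common `true` coordinate.  (Proof: the disjointness matrix factors as `ζ[L,L]ᵀ Λ ζ[L,T]`, and `det ζ[L,T] = ± det ζ[dnSeq s H, H] = ±1`
by a block identity for the unitriangular `ζ[S,S]` and THEOREM S.) [this work] -/
theorem disjoint_matching (S H : Finset (Fin n → Bool))
    (hS : ∀ z ∈ S, ∀ y : Fin n → Bool, (∀ i, y i = true → z i = true) → y ∈ S)
    (hHS : H ⊆ S)
    (hH : ∀ x ∈ H, ∀ y ∈ S, (∀ i, x i = true → y i = true) → y ∈ H)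
    (s : List (Fin n)) (hs : s.Nodup) :
    ∃ ψ : ↥(S \ H) ≃ ↥(S \ dnSeq s H), ∀ x : ↥(S \ H), ∀ i,
      ¬ ((x : Fin n → Bool) i = true ∧ ((ψ x : ↥(S \ dnSeq s H)) : Fin n → Bool) i = true) := by
  classical
  -- the four families
  set L : Finset (Fin n → Bool) := S \ H with hLdef
  set K : Finset (Fin n → Bool) := dnSeq s H with hKdef
  set T : Finset (Fin n → Bool) := S \ K with hTdef
  have hKS : K ⊆ S := dnSeq_subset_of_lower s hHS (update_false_mem_of_lower hS)
  have hL : ∀ z ∈ L, ∀ y : Fin n → Bool, (∀ i, y i = true → z i = true) → y ∈ L := by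
    intro z hz y hyz
    rw [hLdef, Finset.mem_sdiff] at hz ⊢
    exact ⟨hS z hz.1 y hyz, fun hy => hz.2 (hH y hy z hz.1 hyz)⟩
  have hcardK : K.card = H.card := by rw [hKdef, card_dnSeq]
  have hcardT : Fintype.card ↥L = Fintype.card ↥T := by
    rw [Fintype.card_coe, Fintype.card_coe, hLdef, hTdef, Finset.card_sdiff_of_subset hHS,
      Finset.card_sdiff_of_subset hKS, hcardK]
  have hcardHK : Fintype.card ↥H = Fintype.card ↥K := by rw [Fintype.card_coe, Fintype.card_coe, hcardK]
  obtain ⟨eT⟩ : Nonempty (↥L ≃ ↥T) := ⟨Fintype.equivOfCardEq hcardT⟩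
  obtain ⟨eK⟩ : Nonempty (↥H ≃ ↥K) := ⟨Fintype.equivOfCardEq hcardHK⟩
  -- THEOREM S for H
  have hS_thm : IsUnit (Matrix.of fun (b b' : ↥H) => zeta ((eK b : ↥K) : Fin n → Bool) (b' : Fin n → Bool)).det :=
    shift_det H s hs eK
  -- membership facts
  have hLS : ∀ a : ↥L, (a : Fin n → Bool) ∈ S := fun a => (Finset.mem_sdiff.mp (by rw [← hLdef]; exact a.2)).1
  have hLnotH : ∀ a : ↥L, (a : Fin n → Bool) ∉ H := fun a => (Finset.mem_sdiff.mp (by rw [← hLdef]; exact a.2)).2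
  have hTS : ∀ t : ↥T, (t : Fin n → Bool) ∈ S := fun t => (Finset.mem_sdiff.mp (by rw [← hTdef]; exact t.2)).1
  have hTnotK : ∀ t : ↥T, (t : Fin n → Bool) ∉ K := fun t => (Finset.mem_sdiff.mp (by rw [← hTdef]; exact t.2)).2
  -- row and column decompositions of S
  let ρf : ↥L ⊕ ↥H → ↥S := fun p => match p with
    | Sum.inl a => ⟨a, hLS a⟩
    | Sum.inr b => ⟨b, hHS b.2⟩
  have hρinj : Function.Injective ρf := by
    rintro (a | b) (a' | b') h <;> have h' := congrArg (fun z : ↥S => (z : Fin n → Bool)) h <;> simp only [ρf] at h'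
    · exact congrArg Sum.inl (Subtype.ext h')
    · exact absurd (h' ▸ b'.2) (hLnotH a)
    · exact absurd (h'.symm ▸ b.2) (hLnotH a')
    · exact congrArg Sum.inr (Subtype.ext h')
  have hcardS : Fintype.card (↥L ⊕ ↥H) = Fintype.card ↥S := by
    rw [Fintype.card_sum, Fintype.card_coe, Fintype.card_coe, Fintype.card_coe, hLdef,
      Finset.card_sdiff_of_subset hHS, Nat.sub_add_cancel (Finset.card_le_card hHS)]
  let ρ : ↥L ⊕ ↥H ≃ ↥S := Equiv.ofBijective ρf ((Fintype.bijective_iff_injective_and_card ρf).mpr ⟨hρinj, hcardS⟩)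
  let κf : ↥L ⊕ ↥H → ↥S := fun p => match p with
    | Sum.inl a => ⟨(eT a : ↥T), hTS (eT a)⟩
    | Sum.inr b => ⟨(eK b : ↥K), hKS (eK b).2⟩
  have hκinj : Function.Injective κf := by
    rintro (a | b) (a' | b') h <;> have h' := congrArg (fun z : ↥S => (z : Fin n → Bool)) h <;> simp only [κf] at h'
    · exact congrArg Sum.inl (eT.injective (Subtype.ext h'))
    · exact absurd (h' ▸ (eK b').2) (hTnotK (eT a))
    · exact absurd (h'.symm ▸ (eK b).2) (hTnotK (eT a'))
    · exact congrArg Sum.inr (eK.injective (Subtype.ext h'))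
  let κ : ↥L ⊕ ↥H ≃ ↥S := Equiv.ofBijective κf ((Fintype.bijective_iff_injective_and_card κf).mpr ⟨hκinj, hcardS⟩)
  -- the zeta matrix of S and its block form
  set Z : Matrix ↥S ↥S ℤ := Matrix.of fun (i j : ↥S) => zeta (i : Fin n → Bool) (j : Fin n → Bool) with hZ
  have hdetZ : IsUnit Z.det := by rw [hZ, det_zeta_self]; exact isUnit_one
  set A : Matrix ↥L ↥L ℤ := Matrix.of fun (a a' : ↥L) => zeta (a : Fin n → Bool) ((eT a' : ↥T) : Fin n → Bool) with hA
  set Bm : Matrix ↥L ↥H ℤ := Matrix.of fun (a : ↥L) (b : ↥H) => zeta (a : Fin n → Bool) ((eK b : ↥K) : Fin n → Bool) with hBm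
  set C : Matrix ↥H ↥L ℤ := Matrix.of fun (b : ↥H) (a' : ↥L) => zeta (b : Fin n → Bool) ((eT a' : ↥T) : Fin n → Bool) with hC
  set Dm : Matrix ↥H ↥H ℤ := Matrix.of fun (b b' : ↥H) => zeta (b : Fin n → Bool) ((eK b' : ↥K) : Fin n → Bool) with hDm
  have hZblock : Z.submatrix ρ κ = Matrix.fromBlocks A Bm C Dm := by
    ext p q
    rcases p with a | b <;> rcases q with a' | b' <;> rfl
  set B' : Matrix ↥L ↥H ℤ := Matrix.of fun (a : ↥L) (b : ↥H) =>
      (-1 : ℤ) ^ (wt ((eT a : ↥T) : Fin n → Bool) + wt (b : Fin n → Bool)) *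
        zeta ((eT a : ↥T) : Fin n → Bool) (b : Fin n → Bool) with hB'
  set D' : Matrix ↥H ↥H ℤ := Matrix.of fun (b b' : ↥H) =>
      (-1 : ℤ) ^ (wt ((eK b : ↥K) : Fin n → Bool) + wt (b' : Fin n → Bool)) *
        zeta ((eK b : ↥K) : Fin n → Bool) (b' : Fin n → Bool) with hD'
  -- the Möbius sums over S, split as T ⊔ K
  have hsplit : ∀ (f : (Fin n → Bool) → ℤ), ∑ y ∈ S, f y = ∑ a : ↥L, f ((eT a : ↥T) : Fin n → Bool) + ∑ b : ↥H, f ((eK b : ↥K) : Fin n → Bool) := by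
    intro f
    have hTK : S = T ∪ K := by
      rw [hTdef, Finset.sdiff_union_of_subset hKS]
    have hdisj : Disjoint T K := by rw [hTdef]; exact Finset.sdiff_disjoint
    rw [hTK, Finset.sum_union hdisj, ← Finset.sum_coe_sort T, ← Finset.sum_coe_sort K]
    congr 1
    · exact (Equiv.sum_comp eT (fun t : ↥T => f (t : Fin n → Bool))).symm
    · exact (Equiv.sum_comp eK (fun k : ↥K => f (k : Fin n → Bool))).symm
  have hconv : ∀ (x : Fin n → Bool) (b : ↥H),
      ∑ a : ↥L, zeta x ((eT a : ↥T) : Fin n → Bool) * ((-1 : ℤ) ^ (wt ((eT a : ↥T) : Fin n → Bool) + wt (b : Fin n → Bool)) *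
          zeta ((eT a : ↥T) : Fin n → Bool) (b : Fin n → Bool)) +
      ∑ b'' : ↥H, zeta x ((eK b'' : ↥K) : Fin n → Bool) * ((-1 : ℤ) ^ (wt ((eK b'' : ↥K) : Fin n → Bool) + wt (b : Fin n → Bool)) *
          zeta ((eK b'' : ↥K) : Fin n → Bool) (b : Fin n → Bool))
        = if x = (b : Fin n → Bool) then 1 else 0 := by
    intro x b
    rw [← hsplit (fun y => zeta x y * ((-1 : ℤ) ^ (wt y + wt (b : Fin n → Bool)) * zeta y (b : Fin n → Bool)))]
    exact sum_zeta_mu S hS x (b : Fin n → Bool) (hHS b.2)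
  have h12 : A * B' + Bm * D' = 0 := by
    ext a b
    rw [Matrix.add_apply, Matrix.mul_apply, Matrix.mul_apply, Matrix.zero_apply]
    simp only [hA, hB', hBm, hD', Matrix.of_apply]
    rw [hconv (a : Fin n → Bool) b, if_neg]
    intro h
    exact hLnotH a (h ▸ b.2)
  have h22 : C * B' + Dm * D' = 1 := by
    ext b₁ b₂
    rw [Matrix.add_apply, Matrix.mul_apply, Matrix.mul_apply]
    simp only [hC, hB', hDm, hD', Matrix.of_apply]
    rw [hconv (b₁ : Fin n → Bool) b₂]
    by_cases h : b₁ = b₂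
    · subst h; rw [if_pos rfl, Matrix.one_apply_eq]
    · rw [Matrix.one_apply_ne h, if_neg (fun h' => h (Subtype.ext h'))]
  have hprod : Z.submatrix ρ κ * Matrix.fromBlocks 1 B' 0 D' = Matrix.fromBlocks A 0 C 1 := by
    rw [hZblock, Matrix.fromBlocks_multiply]
    simp [h12, h22]
  have hdetA : IsUnit A.det := by
    have h1 := congrArg Matrix.det hprod
    rw [Matrix.det_mul, Matrix.det_fromBlocks_zero₂₁, Matrix.det_fromBlocks_zero₁₂, Matrix.det_one,
      Matrix.det_one, one_mul, mul_one] at h1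
    rw [← h1]
    refine IsUnit.mul ((isUnit_det_submatrix_equiv Z ρ κ).mpr hdetZ) ?_
    -- det D' = ± det ζ[K,H]
    have hD'eq : D' = Matrix.of (fun (b b' : ↥H) => ((-1 : ℤ) ^ wt ((eK b : ↥K) : Fin n → Bool)) *
        (Matrix.of (fun (b b' : ↥H) => ((-1 : ℤ) ^ wt (b' : Fin n → Bool)) *
          (Matrix.of fun (b b' : ↥H) => zeta ((eK b : ↥K) : Fin n → Bool) (b' : Fin n → Bool)) b b')) b b') := by
      ext b b'; simp only [hD', Matrix.of_apply]; rw [pow_add]; ring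
    rw [hD'eq, Matrix.det_mul_column, Matrix.det_mul_row]
    refine IsUnit.mul ?_ (IsUnit.mul ?_ hS_thm)
    · exact isUnit_iff_exists_inv.mpr ⟨∏ i : ↥H, (-1 : ℤ) ^ wt ((eK i : ↥K) : Fin n → Bool), by
        rw [← Finset.prod_mul_distrib]; exact Finset.prod_eq_one (fun i _ => by rw [← pow_add, ← two_mul, pow_mul]; simp)⟩
    · exact isUnit_iff_exists_inv.mpr ⟨∏ i : ↥H, (-1 : ℤ) ^ wt ((i : ↥H) : Fin n → Bool), by
        rw [← Finset.prod_mul_distrib]; exact Finset.prod_eq_one (fun i _ => by rw [← pow_add, ← two_mul, pow_mul]; simp)⟩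
  -- the disjointness matrix and its factorisation
  set DSm : Matrix ↥L ↥L ℤ := Matrix.of fun (a a' : ↥L) => disj (a : Fin n → Bool) ((eT a' : ↥T) : Fin n → Bool) with hDSm
  set ZL : Matrix ↥L ↥L ℤ := Matrix.of fun (b a : ↥L) => zeta (b : Fin n → Bool) (a : Fin n → Bool) with hZL
  set ΛA : Matrix ↥L ↥L ℤ := Matrix.of fun (b a' : ↥L) => ((-1 : ℤ) ^ wt (b : Fin n → Bool)) * A b a' with hΛA
  have hfact : DSm = ZL.transpose * ΛA := by
    ext a a'
    rw [Matrix.mul_apply]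
    simp only [hDSm, hZL, hΛA, hA, Matrix.transpose_apply, Matrix.of_apply]
    rw [← sum_zeta_zeta_disj L hL (a : Fin n → Bool) ((eT a' : ↥T) : Fin n → Bool) a.2, ← Finset.sum_coe_sort L]
  have hdetDS : IsUnit DSm.det := by
    rw [hfact, Matrix.det_mul, Matrix.det_transpose]
    refine IsUnit.mul (by rw [hZL, det_zeta_self]; exact isUnit_one) ?_
    rw [hΛA, Matrix.det_mul_column]
    refine IsUnit.mul ?_ hdetA
    exact isUnit_iff_exists_inv.mpr ⟨∏ i : ↥L, (-1 : ℤ) ^ wt ((i : ↥L) : Fin n → Bool), by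
        rw [← Finset.prod_mul_distrib]; exact Finset.prod_eq_one (fun i _ => by rw [← pow_add, ← two_mul, pow_mul]; simp)⟩
  -- Leibniz: a nonzero permutation term
  have hne : DSm.det ≠ 0 := IsUnit.ne_zero hdetDS
  rw [Matrix.det_apply] at hne
  obtain ⟨σ, _, hσ⟩ := Finset.exists_ne_zero_of_sum_ne_zero hne
  have hσ' : ∀ i : ↥L, DSm (σ i) i ≠ 0 := by
    intro i
    have hprodne : ∏ i, DSm (σ i) i ≠ 0 := by
      intro h0; apply hσ; rw [h0]; simp
    exact (Finset.prod_ne_zero_iff.mp hprodne) i (Finset.mem_univ i)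
  refine ⟨σ.symm.trans eT, fun x i hxi => ?_⟩
  have h1 := hσ' (σ.symm x)
  rw [Equiv.apply_symm_apply] at h1
  simp only [hDSm, Matrix.of_apply] at h1
  unfold disj at h1
  split_ifs at h1 with hd
  · exact hd i (by simpa using hxi)
  · exact h1 rfl


end SahiFComb

end Summit.CriticalPhenomena.PercolationContinuityZ3.Theorems
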